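import Summits.BirchSwinnertonDyer.BirchSwinnertonDyer.Theorems.SignedBaseChangeAnticyclotomicEisensteinDivisibilityOfFacts
import Summits.BirchSwinnertonDyer.BirchSwinnertonDyer.Theorems.SignedBaseChangeAnticyclotomicEisensteinDivisibilityXAcTorsionOfLongoVigni
import HarnessLib

/-!
# Crux `AnticyclotomicEisensteinDivisibility` (stmt-BirchSwinnertonDyer-20727, route SignedBaseChange), line `bdpline`
# v23 — the kernel census with the one-variable torsion input (a) from REFEREED print off `p ∣ h_K`: the crux from
# {Yan–Zhu ×3, Longo–Vigni 2019 Thm. 1.4, Castella–Wan 2024 Thm. 6.8, Greenberg ×6, BSTW24 Prop. 6.27 (i) PRE, BCS25 Prop. 4.2.2},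
# the sub-case statement (a2) at `p ∣ h_K`, and the research stub S1 (helper for stmt-BirchSwinnertonDyer-20727)

Lead prover `bsd-line-sbc-p1` gen 3 (cell `bsd-ssimc`); sequel of `…OfFacts` (p632305), whose census took the input (a)
(`X_ac = X_Gr(E/K_∞⁻)` is `Λ_ac`-torsion at a good supersingular prime) from the OPEN PREPRINT claim CCSS18 Thm. 5.7. The width seat
bsd-line-sbc-p1-w4 (gen 0) has since landed `SignedBaseChangeAcDivXAcTorsionOfLongoVigni.xAcTorsionSS_of_longoVigni_castellaWan`
(p632902): the text of (a) with ONE extra binder `¬ p ∣ h_K` from the two REFEREED typed facts Longo–Vigni (Boll. UMI 2019)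
Thm. 1.4 (`AcSigned.longoVigni2019_thm14_signedSelmerDual_rank_one`, rank one of Kobayashi's signed dual) and Castella–Wan (Math. Ann.
2024) Thm. 6.8 inputs (`AcSigned.castellaWan2024_proofThm68_transferInputs`), everything else kernel-proved (Kobayashi carriers
p631203/p632262, rank transport p631478, `p ∤ h_K ⇒` primes above `p` totally ramified in `K_∞⁻` p632042, transfer p628651). The
registered skeleton v23 (sha16 b8ef25c3ecb6700c) splits (a) accordingly into (a1) `stub_xAcTorsionSS_coprime` (= p632902's type minus
its two fact hypotheses) and (a2) `stub_xAcTorsionSS_classDvd` (`p ∣ h_K`; no refereed source — the primes above `p` need not be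
totally ramified in the anticyclotomic tower; CCSS18 only).

THIS FILE: `torsionSS_of_xAcTorsionSS` and `anticyclotomicEisensteinDivisibility_of_xAcTorsionSS` — the registered composition with
(a) as a HYPOTHESIS (so any source of (a) plugs in); `xAcTorsionSS_of_refereed_of_classDvd` — (a) from the two refereed facts and
the statement (a2); and the census

  `anticyclotomicEisensteinDivisibility_of_refereedFacts :
     YZ26 4.2 (2) → YZ26 4.7 (guarded) → YZ26 3.3 → (∀-closed LV19 Thm. 1.4) → (∀-closed CW24 Thm. 6.8 inputs) → (a2) →
     (six Greenberg facts) → BSTW24 6.27 (i) (PRE) → BCS25 4.2.2 → S1 → AnticyclotomicEisensteinDivisibility`.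

So, off the sub-case `p ∣ h_K` (carried verbatim as the hypothesis (a2)) and the ONE claim-tagged comparison BSTW24 Prop. 6.27 (i),
every named input of the crux along line `bdpline` is REFEREED print, and the only research statement is S1 (G2″). CONDITIONAL on
every displayed hypothesis; nothing is discharged; closes nothing by itself (`--supports stmt-BirchSwinnertonDyer-20727`). No summit
statement / BSD is proved by this file.

References: [LongoVigni2019] M. Longo, S. Vigni, Boll. UMI 12 (2019), Thm. 1.4; [CastellaWan2023] F. Castella, X. Wan, Math. Ann. 389
(2024), Thm. 6.8; [YanZhu2024MainConjNonCM] Thms. 3.3, 4.2, 4.7; [Greenberg2016Selmer] Props. 4.1.1, 4.2.2; [Greenberg2006] Props. 3.2,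
4.1, 4.2, §5 A; [BurungaleSkinnerTianWan2024] Prop. 6.27 (i); [BurungaleCastellaSkinner2025] Prop. 4.2.2;
[CastellaCiperianiSkinnerSprung2018] Thm. 5.7 (the `p ∣ h_K` source, not used here).
-/

-- `Summit.BirchSwinnertonDyer.BirchSwinnertonDyer.…`: summit and sub-problem share a name (D-0017 layout).
set_option linter.dupNamespace false
set_option autoImplicit false

noncomputable section

open scoped Classical

namespace Summit.BirchSwinnertonDyer.BirchSwinnertonDyer.Theorems.SignedBaseChangeAcDivOfFactsRefereed

open Summit.BirchSwinnertonDyer.BirchSwinnertonDyer.Theses.SignedBaseChange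
open Literature.NumberTheory.EllipticCurves

/-- **`X_Gr₂ = X_Gr(E/K̃_∞)` is a torsion `Λ₂`-module** at a good supersingular prime, GRANTED the one-variable input (a) as a
HYPOTHESIS (`hA` = the text of the skeleton's derived `stub_xAcTorsionSS`): glue
`SignedBaseChangeAcDivControlTorsion.stub_torsionSS_of_isTorsion_XAc_of_vanishing_of_away` (p618251) with (V)
`SignedBaseChangeAcDivOfFacts.inertiaVanishingSS` and the PROVED (b₁) `SignedBaseChangeAcDivAwayDiscrepancy.stub_awayDiscrepancySS` (p625395).
[cite: GreenbergLNM1716, §3 Lemmas 3.2–3.3 (away-from-p local conditions)] -/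
theorem torsionSS_of_xAcTorsionSS
    (hA : SignedTwoVariableInputs → Literature.NumberTheory.EllipticCurves.ModularForms.nonempty_modularParametrizationData → ∀ (W : WeierstrassCurve ℚ) [W.IsElliptic] [W.IsGloballyMinimal] (p : ℕ) [Fact p.Prime], 5 ≤ p → W.HasGoodReductionAtPrime p → W.frobeniusTrace p = 0 → Literature.NumberTheory.EllipticCurves.Rank1Residual.Surj W p → ∀ (K : Type) [Field K] [NumberField K] (ι : PadicAlgCl p ≃+* ℂ) (v vbar : IsDedekindDomain.HeightOneSpectrum (NumberField.RingOfIntegers K)) (κ₁ κ₂ : Literature.NumberTheory.EllipticCurves.ZpExtension K p) (γ₁ γ₂ : Field.absoluteGaloisGroup K) [Fact (Literature.NumberTheory.EllipticCurves.ZpExtension.IsTopGeneratorPair κ₁ κ₂ γ₁ γ₂)] [NeZero (NumberField.discr K).natAbs] (N : ℕ) [NeZero N] (f : CuspForm (CongruenceSubgroup.Gamma0 N) 2), Literature.NumberTheory.EllipticCurves.ModularForms.IsNewformOf W f → (N : ℤ) = W.conductorNorm ℤ → Literature.NumberTheory.EllipticCurves.IsImaginaryQuadratic K → ((Ideal.span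 {(p : ℤ)}).primesOver (NumberField.RingOfIntegers K)).ncard = 2 → ((p : ℕ) : NumberField.RingOfIntegers K) ∈ v.asIdeal → ((p : ℕ) : NumberField.RingOfIntegers K) ∈ vbar.asIdeal → vbar ≠ v → (∀ (w : NumberField.InfinitePlace K) (k : NumberField.RingOfIntegers K), k ∈ v.asIdeal ↔ ‖ι.symm (w.embedding (k : K))‖ < 1) → IsCoprime (N : ℤ) (NumberField.discr K) → (∀ ℓ : ℕ, ℓ.Prime → ℓ ∣ N → ((Ideal.span {(ℓ : ℤ)}).primesOver (NumberField.RingOfIntegers K)).ncard = 2) → Odd (NumberField.discr K) → NumberField.discr K ≠ -3 → κ₁.IsCyclotomic → κ₂.IsAnticyclotomic → (haveI : Fact (κ₂.IsTopGenerator γ₂) := ⟨Literature.NumberTheory.EllipticCurves.YanZhu2026.isTopGenerator_of_pair (κ₁ := κ₁) (γ₁ := γ₁)⟩; Module.IsTorsion (Literature.NumberTheory.EllipticCurves.IwasawaAlgebra p) (Literature.NumberTheory.EllipticCurves.Castella2018.AcSelmer.XAc (W.baseChange K) p κ₂ vbar ∅ γ₂))) :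
    SignedTwoVariableInputs → Literature.NumberTheory.EllipticCurves.ModularForms.nonempty_modularParametrizationData → ∀ (W : WeierstrassCurve ℚ) [W.IsElliptic] [W.IsGloballyMinimal] (p : ℕ) [Fact p.Prime], 5 ≤ p → W.HasGoodReductionAtPrime p → W.frobeniusTrace p = 0 → Literature.NumberTheory.EllipticCurves.Rank1Residual.Surj W p → ∀ (K : Type) [Field K] [NumberField K] (ι : PadicAlgCl p ≃+* ℂ) (v vbar : IsDedekindDomain.HeightOneSpectrum (NumberField.RingOfIntegers K)) (κ₁ κ₂ : Literature.NumberTheory.EllipticCurves.ZpExtension K p) (γ₁ γ₂ : Field.absoluteGaloisGroup K) [Fact (Literature.NumberTheory.EllipticCurves.ZpExtension.IsTopGeneratorPair κ₁ κ₂ γ₁ γ₂)] [NeZero (NumberField.discr K).natAbs] (N : ℕ) [NeZero N] (f : CuspForm (CongruenceSubgroup.Gamma0 N) 2), Literature.NumberTheory.EllipticCurves.ModularForms.IsNewformOf W f → (N : ℤ) = W.conductorNorm ℤ → Literature.NumberTheory.EllipticCurves.IsImaginaryQuadratic K → ((Ideal.span {(p : ℤ)}).primesOver (NumberField.RingOfIntegers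 K)).ncard = 2 → ((p : ℕ) : NumberField.RingOfIntegers K) ∈ v.asIdeal → ((p : ℕ) : NumberField.RingOfIntegers K) ∈ vbar.asIdeal → vbar ≠ v → (∀ (w : NumberField.InfinitePlace K) (k : NumberField.RingOfIntegers K), k ∈ v.asIdeal ↔ ‖ι.symm (w.embedding (k : K))‖ < 1) → IsCoprime (N : ℤ) (NumberField.discr K) → (∀ ℓ : ℕ, ℓ.Prime → ℓ ∣ N → ((Ideal.span {(ℓ : ℤ)}).primesOver (NumberField.RingOfIntegers K)).ncard = 2) → Odd (NumberField.discr K) → NumberField.discr K ≠ -3 → κ₁.IsCyclotomic → κ₂.IsAnticyclotomic → Module.IsTorsion (Literature.NumberTheory.EllipticCurves.IwasawaAlgebra₂ p) ((W.baseChange K).XGr₂ p κ₁ κ₂ vbar γ₁ γ₂) := by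
  intro hIn hmodP W _ _ p _ hp hgood ha0 hs K _ _ ι v vbar κ₁ κ₂ γ₁ γ₂ _ _ N _ f hf hN hK hsplit hv hvbar hvv hι hcop hHeeg hodd
    hne3 hκ₁ hκ₂
  exact Summit.BirchSwinnertonDyer.BirchSwinnertonDyer.Theorems.SignedBaseChangeAcDivControlTorsion.stub_torsionSS_of_isTorsion_XAc_of_vanishing_of_away
    W p hp hgood ha0 hs K ι v vbar κ₁ κ₂ γ₁ γ₂ N f hf hN hK hsplit hv hvbar hvv hι hcop hHeeg hodd hne3 hκ₁ hκ₂
    (hA hIn hmodP W p hp hgood ha0 hs K ι v vbar κ₁ κ₂ γ₁ γ₂ N f hf hN hK hsplit hv hvbar hvv hι hcop hHeeg hodd hne3 hκ₁ hκ₂)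
    (Summit.BirchSwinnertonDyer.BirchSwinnertonDyer.Theorems.SignedBaseChangeAcDivOfFacts.inertiaVanishingSS hIn hmodP W p hp hgood ha0 hs K ι v vbar κ₁ κ₂ γ₁ γ₂ N f hf hN hK hsplit hv hvbar hvv hι hcop hHeeg hodd hne3 hκ₁ hκ₂)
    (Summit.BirchSwinnertonDyer.BirchSwinnertonDyer.Theorems.SignedBaseChangeAcDivAwayDiscrepancy.stub_awayDiscrepancySS hIn hmodP W p hp hgood ha0 hs K ι v vbar κ₁ κ₂ γ₁ γ₂ N f hf hN hK hsplit hv hvbar hvv hι hcop hHeeg hodd hne3 hκ₁ hκ₂ (Summit.BirchSwinnertonDyer.BirchSwinnertonDyer.Theorems.SignedBaseChangeAcDivOfFacts.inertiaVanishingSS hIn hmodP W p hp hgood ha0 hs K ι v vbar κ₁ κ₂ γ₁ γ₂ N f hf hN hK hsplit hv hvbar hvv hι hcop hHeeg hodd hne3 hκ₁ hκ₂))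

/-- **The v21/v23 composition with (a) as a hypothesis**: `AnticyclotomicEisensteinDivisibility` from the named facts {Yan–Zhu 2026 Thms.
4.2 (2), 4.7 (guarded), 3.3; Greenberg 2016 Props. 4.1.1/4.2.2 and Greenberg 2006 Props. 3.2/4.1/4.2/§5 A; BSTW24 Prop. 6.27 (i) (PRE); BCS25
Prop. 4.2.2}, the one-variable torsion statement (a) (`hA`) and the research statement S1 (`hS1`), by the registered composition (same proof
as `SignedBaseChangeAcDivOfFacts.anticyclotomicEisensteinDivisibility_of_facts`, p632305, with `hA` for CCSS18). CONDITIONAL; nothing about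
BSD is proved. [cite: YanZhu2024MainConjNonCM, Thms. 3.3, 4.2 (2), 4.7] [cite: BurungaleCastellaSkinner2025, Prop. 4.2.2]
[claim: BurungaleSkinnerTianWan2024, status: under-review] [cite: Greenberg2016Selmer, Prop. 4.1.1] -/
theorem anticyclotomicEisensteinDivisibility_of_xAcTorsionSS
    (h42 : Literature.NumberTheory.EllipticCurves.YanZhu2026.thm42_XGr₂_isTorsion_charIdeal_le_greenbergAnyRoot)
    (h47 : Literature.NumberTheory.EllipticCurves.YanZhu2026.thm47_ord_localised_iff_greenbergAnyRoot_localised_guarded)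
    (h33 : Literature.NumberTheory.EllipticCurves.YanZhu2026.thm33_exists_isHidaRankinLFunction)
    (hA : SignedTwoVariableInputs → Literature.NumberTheory.EllipticCurves.ModularForms.nonempty_modularParametrizationData → ∀ (W : WeierstrassCurve ℚ) [W.IsElliptic] [W.IsGloballyMinimal] (p : ℕ) [Fact p.Prime], 5 ≤ p → W.HasGoodReductionAtPrime p → W.frobeniusTrace p = 0 → Literature.NumberTheory.EllipticCurves.Rank1Residual.Surj W p → ∀ (K : Type) [Field K] [NumberField K] (ι : PadicAlgCl p ≃+* ℂ) (v vbar : IsDedekindDomain.HeightOneSpectrum (NumberField.RingOfIntegers K)) (κ₁ κ₂ : Literature.NumberTheory.EllipticCurves.ZpExtension K p) (γ₁ γ₂ : Field.absoluteGaloisGroup K) [Fact (Literature.NumberTheory.EllipticCurves.ZpExtension.IsTopGeneratorPair κ₁ κ₂ γ₁ γ₂)] [NeZero (NumberField.discr K).natAbs] (N : ℕ) [NeZero N] (f : CuspForm (CongruenceSubgroup.Gamma0 N) 2), Literature.NumberTheory.EllipticCurves.ModularForms.IsNewformOf W f → (N : ℤ) = W.conductorNorm ℤ → Literature.NumberTheory.EllipticCurves.IsImaginaryQuadratic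 K → ((Ideal.span {(p : ℤ)}).primesOver (NumberField.RingOfIntegers K)).ncard = 2 → ((p : ℕ) : NumberField.RingOfIntegers K) ∈ v.asIdeal → ((p : ℕ) : NumberField.RingOfIntegers K) ∈ vbar.asIdeal → vbar ≠ v → (∀ (w : NumberField.InfinitePlace K) (k : NumberField.RingOfIntegers K), k ∈ v.asIdeal ↔ ‖ι.symm (w.embedding (k : K))‖ < 1) → IsCoprime (N : ℤ) (NumberField.discr K) → (∀ ℓ : ℕ, ℓ.Prime → ℓ ∣ N → ((Ideal.span {(ℓ : ℤ)}).primesOver (NumberField.RingOfIntegers K)).ncard = 2) → Odd (NumberField.discr K) → NumberField.discr K ≠ -3 → κ₁.IsCyclotomic → κ₂.IsAnticyclotomic → (haveI : Fact (κ₂.IsTopGenerator γ₂) := ⟨Literature.NumberTheory.EllipticCurves.YanZhu2026.isTopGenerator_of_pair (κ₁ := κ₁) (γ₁ := γ₁)⟩; Module.IsTorsion (Literature.NumberTheory.EllipticCurves.IwasawaAlgebra p) (Literature.NumberTheory.EllipticCurves.Castella2018.AcSelmer.XAc (W.baseChange K) p κ₂ vbar ∅ γ₂)))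
    (hGr : Literature.NumberTheory.IwasawaTheory.Greenberg2016.prop411_selmer_isAlmostDivisible ∧ Literature.NumberTheory.IwasawaTheory.Greenberg2016.prop422_localCohomology_isAlmostDivisible ∧ Literature.NumberTheory.IwasawaTheory.Greenberg2006.sec5A_localH2_subsingleton_of_LOC1 ∧ Literature.NumberTheory.IwasawaTheory.Greenberg2006.prop41_globalEulerPoincareCorank ∧ Literature.NumberTheory.IwasawaTheory.Greenberg2006.prop42_localEulerPoincareCorank ∧ Literature.NumberTheory.IwasawaTheory.Greenberg2006.prop32_cohomology_isCofinitelyGenerated)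
    (h627 : Literature.NumberTheory.EllipticCurves.BurungaleSkinnerTianWan2024.prop627_span_minus_eq_span_bdp_supersingular_PRE)
    (h422e : Literature.NumberTheory.EllipticCurves.BurungaleCastellaSkinner2025.prop422_exists_isBDPLFunction_mu_eq_zero)
    (hS1 : SignedTwoVariableInputs → Literature.NumberTheory.EllipticCurves.ModularForms.nonempty_modularParametrizationData → ∀ (W : WeierstrassCurve ℚ) [W.IsElliptic] [W.IsGloballyMinimal] (p : ℕ) [Fact p.Prime], 5 ≤ p → W.HasGoodReductionAtPrime p → W.frobeniusTrace p = 0 → Literature.NumberTheory.EllipticCurves.Rank1Residual.Surj W p → ∀ (K : Type) [Field K] [NumberField K] (ι : PadicAlgCl p ≃+* ℂ) (v vbar : IsDedekindDomain.HeightOneSpectrum (NumberField.RingOfIntegers K)) (κ₁ κ₂ : Literature.NumberTheory.EllipticCurves.ZpExtension K p) (γ₁ γ₂ : Field.absoluteGaloisGroup K) [Fact (Literature.NumberTheory.EllipticCurves.ZpExtension.IsTopGeneratorPair κ₁ κ₂ γ₁ γ₂)] [NeZero (NumberField.discr K).natAbs] (N : ℕ) [NeZero N] (f : CuspForm (CongruenceSubgroup.Gamma0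 N) 2), Literature.NumberTheory.EllipticCurves.ModularForms.IsNewformOf W f → (N : ℤ) = W.conductorNorm ℤ → Literature.NumberTheory.EllipticCurves.IsImaginaryQuadratic K → ((Ideal.span {(p : ℤ)}).primesOver (NumberField.RingOfIntegers K)).ncard = 2 → ((p : ℕ) : NumberField.RingOfIntegers K) ∈ v.asIdeal → ((p : ℕ) : NumberField.RingOfIntegers K) ∈ vbar.asIdeal → vbar ≠ v → (∀ (w : NumberField.InfinitePlace K) (k : NumberField.RingOfIntegers K), k ∈ v.asIdeal ↔ ‖ι.symm (w.embedding (k : K))‖ < 1) → IsCoprime (N : ℤ) (NumberField.discr K) → (∀ ℓ : ℕ, ℓ.Prime → ℓ ∣ N → ((Ideal.span {(ℓ : ℤ)}).primesOver (NumberField.RingOfIntegers K)).ncard = 2) → Odd (NumberField.discr K) → NumberField.discr K ≠ -3 → κ₁.IsCyclotomic → κ₂.IsAnticyclotomic → (haveI : Fact (κ₂.IsTopGenerator γ₂) := ⟨Literature.NumberTheory.EllipticCurves.YanZhu2026.isTopGenerator_of_pair (κ₁ := κ₁) (γ₁ := γ₁)⟩; Module.IsTorsion (Literature.NumberTheory.EllipticCurves.IwasawaAlgebra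 p) (Literature.NumberTheory.EllipticCurves.Castella2018.AcSelmer.XAc (W.baseChange K) p κ₂ vbar ∅ γ₂)) → ∀ (ΩK : ℂ) (Ωp' : (Literature.NumberTheory.EllipticCurves.unrIntegers p)ˣ) (L : Literature.NumberTheory.EllipticCurves.UnrSeries p), ΩK ≠ 0 → Literature.NumberTheory.EllipticCurves.IsBDPLFunction ι v κ₂ γ₂ f ΩK ((Ωp' : Literature.NumberTheory.EllipticCurves.unrIntegers p) : PadicComplex p) L → ∀ J : ℤ_[p] →+* PadicComplexInt p, (∀ x : ℤ_[p], ((J x : PadicComplexInt p) : PadicComplex p) = ((x : ℚ_[p]) : PadicComplex p)) → ∀ (J₀ : Literature.NumberTheory.EllipticCurves.unrIntegers p →+* PadicComplexInt p), (∀ x : Literature.NumberTheory.EllipticCurves.unrIntegers p, ((J₀ x : PadicComplexInt p) : PadicComplex p) = (x : PadicComplex p)) → ∃ k : ℕ, ∀ y ∈ (haveI : Fact (κ₂.IsTopGenerator γ₂) := ⟨Literature.NumberTheory.EllipticCurves.YanZhu2026.isTopGenerator_of_pair (κ₁ := κ₁) (γ₁ := γ₁)⟩; Literature.NumberTheory.EllipticCurves.Castella2018.AcSelmer.XAc.charIdeal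 (W.baseChange K) p κ₂ vbar ∅ γ₂).map (PowerSeries.map J), PowerSeries.C (((p : ℕ) : PadicComplexInt p) ^ k) * y ∈ Ideal.span {PowerSeries.map J₀ L}) :
    Summit.BirchSwinnertonDyer.BirchSwinnertonDyer.Theses.SignedBaseChange.AnticyclotomicEisensteinDivisibility := by
  intro hIn hmodP W _ _ p _ hp hgood hs K _ _ ι v vbar κ₁ κ₂ γ₁ γ₂ _ _ N _ f hf hN hK hsplit hv hvbar hvv hι hcop hHeeg hodd
    hne3 hκ₁ hκ₂ Ω δ Ωp LK G hΩ hδ hLK hG J hJ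
  by_cases hap : ¬ (p : ℤ) ∣ W.frobeniusTrace p
  · -- ordinary slice: print (stub_ordSlice)
    exact Summit.BirchSwinnertonDyer.BirchSwinnertonDyer.Theorems.SignedBaseChangeAcDivOrdinary.acDivChild_of_goodOrd h42 h47 h33 hIn hmodP W p hp hgood ⟨hgood, hap⟩ hs K ι v vbar κ₁ κ₂ γ₁ γ₂ N f hf hN hK hsplit hv hvbar hvv hι hcop hHeeg
      hodd hne3 hκ₁ hκ₂ Ω δ Ωp LK G hΩ hδ hLK hG J hJ
  have ha0 : W.frobeniusTrace p = 0 := (W.natCast_dvd_frobeniusTrace_iff_eq_zero p hp hgood).mp (not_not.mp hap)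
  have hγ₂ : κ₂.IsTopGenerator γ₂ := YanZhu2026.isTopGenerator_of_pair (κ₁ := κ₁) (γ₁ := γ₁)
  haveI : Fact (κ₂.IsTopGenerator γ₂) := ⟨hγ₂⟩
  -- S2a (v5): finite generation = Nakayama for duals over Λ₂ (stub_nakayamaDualTwoVar) + finiteness of `unrSelmer₂[𝔪]` (stub_finitePieceSS)
  haveI : (W.baseChange K).IsElliptic := by rw [WeierstrassCurve.baseChange]; infer_instance
  have hpair : ZpExtension.IsTopGeneratorPair κ₁ κ₂ γ₁ γ₂ := Fact.out
  have hfin := Summit.BirchSwinnertonDyer.BirchSwinnertonDyer.Theorems.SignedBaseChangeAcDivFinitePiece.stub_finitePieceSS K (W.baseChange K) p κ₁ κ₂ vbar γ₁ γ₂ hpair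
  haveI hfg : Module.Finite (IwasawaAlgebra₂ p) ((W.baseChange K).XGr₂ p κ₁ κ₂ vbar γ₁ γ₂) := by
    refine Summit.BirchSwinnertonDyer.BirchSwinnertonDyer.Theorems.SignedBaseChangeAcDivNakayamaTwoVar.stub_nakayamaDualTwoVar p (unrSelmer₂ κ₁ κ₂ (WeierstrassCurve.geomPrimaryTorsion (W.baseChange K) p) vbar)
      ((W.baseChange K).XGr₂ p κ₁ κ₂ vbar γ₁ γ₂)
      (conjSel₂ κ₁ κ₂ (WeierstrassCurve.geomPrimaryTorsion (W.baseChange K) p) vbar γ₁ - 1)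
      (conjSel₂ κ₁ κ₂ (WeierstrassCurve.geomPrimaryTorsion (W.baseChange K) p) vbar γ₂ - 1)
      (AddMonoidHom.id _) Function.bijective_id (fun x s ↦ ?_) (fun x s ↦ ?_) (fun c x s k hk ↦ ?_)
      (TwoVariableSelmer.isLocNil₂_conjSel₂ (WeierstrassCurve.geomPrimaryTorsion (W.baseChange K) p) vbar hpair
        ((W.baseChange K).exists_pow_smul_geomPrimaryTorsion_eq_zero p) ((W.baseChange K).isOpen_stabilizer_geomPrimaryTorsion' p)) ?_
    · show ((PowerSeries.X : IwasawaAlgebra₂ p) • x) s = x ((conjSel₂ κ₁ κ₂ (WeierstrassCurve.geomPrimaryTorsion (W.baseChange K) p) vbar γ₁ - 1) s)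
      rw [WeierstrassCurve.XGr₂.X_smul_apply, IwasawaDual.End_sub_apply, AddMonoid.End.one_apply]
      exact (AddMonoidHom.map_sub (show unrSelmer₂ κ₁ κ₂ (WeierstrassCurve.geomPrimaryTorsion (W.baseChange K) p) vbar →+
        AddCircle (1 : ℚ) from x) _ _).symm
    · show ((PowerSeries.C (PowerSeries.X : IwasawaAlgebra p) : IwasawaAlgebra₂ p) • x) s = x ((conjSel₂ κ₁ κ₂ (WeierstrassCurve.geomPrimaryTorsion (W.baseChange K) p) vbar γ₂ - 1) s)
      rw [WeierstrassCurve.XGr₂.CX_smul_apply, IwasawaDual.End_sub_apply, AddMonoid.End.one_apply]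
      exact (AddMonoidHom.map_sub (show unrSelmer₂ κ₁ κ₂ (WeierstrassCurve.geomPrimaryTorsion (W.baseChange K) p) vbar →+
        AddCircle (1 : ℚ) from x) _ _).symm
    · show ((PowerSeries.C (PowerSeries.C c : IwasawaAlgebra p) : IwasawaAlgebra₂ p) • x) s = (PadicInt.toZModPow k c).val • x s
      exact WeierstrassCurve.XGr₂.CC_smul_apply (W.baseChange K) p κ₁ κ₂ vbar γ₁ γ₂ c x hk
    · refine hfin.subset fun s hs ↦ ?_
      obtain ⟨h0, h1, h2⟩ := hs
      rw [IwasawaDual.End_sub_apply, AddMonoid.End.one_apply, sub_eq_zero] at h1 h2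
      exact ⟨h0, h1, h2⟩
  have htors := torsionSS_of_xAcTorsionSS hA hIn hmodP W p hp hgood ha0 hs K ι v vbar κ₁ κ₂ γ₁ γ₂ N f hf hN hK hsplit hv hvbar hvv hι hcop hHeeg hodd hne3 hκ₁ hκ₂
  obtain ⟨fc, hfc⟩ := Summit.BirchSwinnertonDyer.BirchSwinnertonDyer.Theorems.SignedBaseChangeAcDivControl.stub_controlSurjSS hIn hmodP W p hp hgood ha0 hs K ι v vbar κ₁ κ₂ γ₁ γ₂ N f hf hN hK hsplit hv hvbar hvv hι hcop hHeeg hodd hne3 hκ₁ hκ₂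
  obtain ⟨ΩK₃, Ωp₃, L₃, hΩK₃, hL₃, hcmp⟩ :=
    Summit.BirchSwinnertonDyer.BirchSwinnertonDyer.Theorems.SignedBaseChangeAcDivMinusIsBDPSS.stub_minusIsBDP_ss_of_facts h627 h422e hIn hmodP W p hp hgood ha0 hs K ι v vbar κ₁ κ₂ γ₁ γ₂ N f hf hN hK hsplit hv hvbar hvv hι hcop hHeeg hodd hne3 hκ₁ hκ₂ Ω δ Ωp LK G hΩ hδ hLK hG
  -- v8 dichotomy on `(T₁) ∈ Supp X_Gr₂`: if so, the specialised ideal is `⊥` and nothing else is needed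
  by_cases h0 : Literature.NumberTheory.EllipticCurves.Module.lengthAt (IwasawaAlgebra₂ p) ((W.baseChange K).XGr₂ p κ₁ κ₂ vbar γ₁ γ₂)
      ⟨Ideal.span {(PowerSeries.X : IwasawaAlgebra₂ p)}, PowerSeries.span_X_isPrime⟩ = 0
  swap
  · rw [show WeierstrassCurve.XGr₂.charIdeal (W.baseChange K) p κ₁ κ₂ vbar γ₁ γ₂ =
        Literature.NumberTheory.EllipticCurves.Module.charIdeal (IwasawaAlgebra₂ p) ((W.baseChange K).XGr₂ p κ₁ κ₂ vbar γ₁ γ₂) from rfl,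
      Summit.BirchSwinnertonDyer.BirchSwinnertonDyer.Theorems.SignedBaseChangeAcDivSpecialization.S2.map_toUnr₂_map_constantCoeff_eq_bot_of_lengthAt_ne_zero
        p _ htors h0 J]
    exact bot_le
  -- `(T₁) ∉ Supp X_Gr₂`: a killing element `s` with `s(0) ≠ 0` makes `X_ac` (a quotient of `X_Gr₂/T₁`) `Λ_ac`-torsion
  obtain ⟨s, hsX, hsm⟩ :=
    Summit.BirchSwinnertonDyer.BirchSwinnertonDyer.Theorems.SignedBaseChangeAcDivSpecialization.LocalLength.exists_notMem_forall_smul_eq_zero_of_lengthAt_eq_zero h0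
  have hs0 : PowerSeries.constantCoeff s ≠ 0 := fun h ↦ hsX
    ((Summit.BirchSwinnertonDyer.BirchSwinnertonDyer.Theorems.SignedBaseChangeAcDivSpecialization.PowerSeriesSpecialization.mem_span_X_iff
      (A := IwasawaAlgebra p)).mpr h)
  -- v10: finite exponent of `X_Gr₂[T₁]` (stub) in place of no-pseudo-null
  have hm := Summit.BirchSwinnertonDyer.BirchSwinnertonDyer.Theorems.SignedBaseChangeAcDivOfFacts.finiteExponentSS_of_facts hGr hIn hmodP W p hp hgood ha0 hs K ι v vbar κ₁ κ₂ γ₁ γ₂ N f hf hN hK hsplit hv hvbar hvv hι hcop hHeeg hodd hne3 hκ₁ hκ₂ h0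
  have hXacTors : Module.IsTorsion (IwasawaAlgebra p) (Castella2018.AcSelmer.XAc (W.baseChange K) p κ₂ vbar ∅ γ₂) := by
    letI : Module (IwasawaAlgebra p) (QuotSMulTop (PowerSeries.X : IwasawaAlgebra₂ p) ((W.baseChange K).XGr₂ p κ₁ κ₂ vbar γ₁ γ₂)) :=
      Module.compHom _ (PowerSeries.C (R := IwasawaAlgebra p))
    have hq : ∀ q : QuotSMulTop (PowerSeries.X : IwasawaAlgebra₂ p) ((W.baseChange K).XGr₂ p κ₁ κ₂ vbar γ₁ γ₂),
        (PowerSeries.constantCoeff s) • q = 0 := by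
      intro q
      show (PowerSeries.C (PowerSeries.constantCoeff s) : IwasawaAlgebra₂ p) • q = 0
      have e : (PowerSeries.C (PowerSeries.constantCoeff s) : IwasawaAlgebra₂ p) =
          (PowerSeries.C (PowerSeries.constantCoeff s) - s) + s := by ring
      obtain ⟨x, rfl⟩ := Submodule.Quotient.mk_surjective _ q
      rw [e, add_smul,
        Summit.BirchSwinnertonDyer.BirchSwinnertonDyer.Theorems.SignedBaseChangeAcDivSpecialization.PowerSeriesSpecialization.smul_quotSMulTop_eq_zero
          _ _ (by rw [map_sub, PowerSeries.constantCoeff_C, sub_self]),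
        zero_add, ← Submodule.Quotient.mk_smul, hsm, Submodule.Quotient.mk_zero]
    intro y
    obtain ⟨q, rfl⟩ := hfc y
    refine ⟨⟨PowerSeries.constantCoeff s, mem_nonZeroDivisors_of_ne_zero hs0⟩, ?_⟩
    show (PowerSeries.constantCoeff s) • fc q = 0
    rw [← LinearMap.map_smul, hq, map_zero]
  -- v9: μ(G⁻) = 0 from conjunct 1 of the crux's own antecedent (BCS25 Prop. 4.2.2; (irr_K) ⟸ Surj)
  have hμ : GreenbergVatsal2000.HasUnitContent (UnrSeries₂.minus G) :=
    Summit.BirchSwinnertonDyer.BirchSwinnertonDyer.Theorems.SignedBaseChangeAcDivRatToInt.hasUnitContent_minus_of_prop422 hIn.1 W hp hgood hs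
      K ι v vbar κ₁ κ₂ γ₁ γ₂ hf hN hK hsplit hv hvbar hvv hι hcop hHeeg hodd hne3 hκ₁ hκ₂ hΩ hδ hLK hG
  let J₀ : unrIntegers p →+* PadicComplexInt p := Summit.BirchSwinnertonDyer.Rank1Residual.X11b.R1.unrToCpInt p
  have hJ₀ : ∀ x : unrIntegers p, ((J₀ x : PadicComplexInt p) : PadicComplex p) = (x : PadicComplex p) :=
    Summit.BirchSwinnertonDyer.Rank1Residual.X11b.R1.coe_unrToCpInt p
  -- v10: RATIONAL specialisation `T₁ ↦ 0` (full Herbrand formula; the factor ch(X_Gr₂[T₁]) is a power of p)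
  obtain ⟨k₂, hk₂⟩ := Summit.BirchSwinnertonDyer.BirchSwinnertonDyer.Theorems.SignedBaseChangeAcDivSpecialization.S2.xGr₂_specialization_le_rat
    (W.baseChange K) p κ₁ κ₂ vbar γ₁ γ₂ ⟨s, hs0, hsm⟩ hm fc hfc J
  -- v11: S1 (rational, every-frame form) applied to S3's OWN frame `L₃` — no frame rigidity needed any more
  obtain ⟨k₁, hk₁⟩ := hS1 hIn hmodP W p hp hgood ha0 hs K ι v vbar κ₁ κ₂ γ₁ γ₂ N f hf hN hK hsplit hv hvbar hvv hι hcop hHeeg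
    hodd hne3 hκ₁ hκ₂ hXacTors ΩK₃ Ωp₃ L₃ hΩK₃ hL₃ J hJ J₀ hJ₀
  -- v10: rational S2 + rational S1 + μ(G⁻) = 0 ⟹ the integral inclusion (one-variable cancellation, k = k₁ + k₂)
  refine Summit.BirchSwinnertonDyer.BirchSwinnertonDyer.Theorems.SignedBaseChangeAcDivRatToInt.le_span_of_forall_C_pow_mul_mem_of_hasUnitContent
    hμ (k := k₁ + k₂) fun y hy ↦ ?_
  rw [hcmp J₀ hJ₀, pow_add, map_mul, mul_assoc]
  exact hk₁ _ (hk₂ y hy)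

/-- **(a) from REFEREED print off `p ∣ h_K`**: the one-variable torsion of `X_ac` at a good supersingular prime from Longo–Vigni 2019
Thm. 1.4 and Castella–Wan 2024 Thm. 6.8 (through the width seat's `xAcTorsionSS_of_longoVigni_castellaWan`, p632902) when `p ∤ h_K`, and
from the hypothesis (a2) (= the registered `stub_xAcTorsionSS_classDvd`, verbatim) when `p ∣ h_K`.
[cite: LongoVigni2019, Thm. 1.4] [cite: CastellaWan2023, Thm. 6.8] -/
theorem xAcTorsionSS_of_refereed_of_classDvd
    (hLV : ∀ (W : WeierstrassCurve ℚ) [W.IsGloballyMinimal] (K : Type) [Field K] [NumberField K]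
      (p : ℕ) [Fact p.Prime] (κ : ZpExtension K p) (𝔭 𝔭' : IsDedekindDomain.HeightOneSpectrum (NumberField.RingOfIntegers K)),
      AcSigned.longoVigni2019_thm14_signedSelmerDual_rank_one W K p κ 𝔭 𝔭')
    (hCW : ∀ (N : ℕ) [NeZero N] (W : WeierstrassCurve ℚ) [W.IsGloballyMinimal] (K : Type) [Field K]
      [NumberField K] (p : ℕ) [Fact p.Prime] (κ : ZpExtension K p) (𝔭 𝔭' : IsDedekindDomain.HeightOneSpectrum (NumberField.RingOfIntegers K)),
      AcSigned.castellaWan2024_proofThm68_transferInputs N W K p κ 𝔭 𝔭')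
    (hA2 : SignedTwoVariableInputs → Literature.NumberTheory.EllipticCurves.ModularForms.nonempty_modularParametrizationData → ∀ (W : WeierstrassCurve ℚ) [W.IsElliptic] [W.IsGloballyMinimal] (p : ℕ) [Fact p.Prime], 5 ≤ p → W.HasGoodReductionAtPrime p → W.frobeniusTrace p = 0 → Literature.NumberTheory.EllipticCurves.Rank1Residual.Surj W p → ∀ (K : Type) [Field K] [NumberField K] (ι : PadicAlgCl p ≃+* ℂ) (v vbar : IsDedekindDomain.HeightOneSpectrum (NumberField.RingOfIntegers K)) (κ₁ κ₂ : Literature.NumberTheory.EllipticCurves.ZpExtension K p) (γ₁ γ₂ : Field.absoluteGaloisGroup K) [Fact (Literature.NumberTheory.EllipticCurves.ZpExtension.IsTopGeneratorPair κ₁ κ₂ γ₁ γ₂)] [NeZero (NumberField.discr K).natAbs] (N : ℕ) [NeZero N] (f : CuspForm (CongruenceSubgroup.Gamma0 N) 2), Literature.NumberTheory.EllipticCurves.ModularForms.IsNewformOf W f → (N : ℤ) = W.conductorNorm ℤ → Literature.NumberTheory.EllipticCurves.IsImaginaryQuadratic K → ((Ideal.span {(p : ℤ)}).primesOver (NumberField.RingOfIntegers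 K)).ncard = 2 → ((p : ℕ) : NumberField.RingOfIntegers K) ∈ v.asIdeal → ((p : ℕ) : NumberField.RingOfIntegers K) ∈ vbar.asIdeal → vbar ≠ v → (∀ (w : NumberField.InfinitePlace K) (k : NumberField.RingOfIntegers K), k ∈ v.asIdeal ↔ ‖ι.symm (w.embedding (k : K))‖ < 1) → IsCoprime (N : ℤ) (NumberField.discr K) → (∀ ℓ : ℕ, ℓ.Prime → ℓ ∣ N → ((Ideal.span {(ℓ : ℤ)}).primesOver (NumberField.RingOfIntegers K)).ncard = 2) → Odd (NumberField.discr K) → NumberField.discr K ≠ -3 → κ₁.IsCyclotomic → κ₂.IsAnticyclotomic → p ∣ NumberField.classNumber K → (haveI : Fact (κ₂.IsTopGenerator γ₂) := ⟨Literature.NumberTheory.EllipticCurves.YanZhu2026.isTopGenerator_of_pair (κ₁ := κ₁) (γ₁ := γ₁)⟩; Module.IsTorsion (Literature.NumberTheory.EllipticCurves.IwasawaAlgebra p) (Literature.NumberTheory.EllipticCurves.Castella2018.AcSelmer.XAc (W.baseChange K) p κ₂ vbar ∅ γ₂))) :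
    SignedTwoVariableInputs → Literature.NumberTheory.EllipticCurves.ModularForms.nonempty_modularParametrizationData → ∀ (W : WeierstrassCurve ℚ) [W.IsElliptic] [W.IsGloballyMinimal] (p : ℕ) [Fact p.Prime], 5 ≤ p → W.HasGoodReductionAtPrime p → W.frobeniusTrace p = 0 → Literature.NumberTheory.EllipticCurves.Rank1Residual.Surj W p → ∀ (K : Type) [Field K] [NumberField K] (ι : PadicAlgCl p ≃+* ℂ) (v vbar : IsDedekindDomain.HeightOneSpectrum (NumberField.RingOfIntegers K)) (κ₁ κ₂ : Literature.NumberTheory.EllipticCurves.ZpExtension K p) (γ₁ γ₂ : Field.absoluteGaloisGroup K) [Fact (Literature.NumberTheory.EllipticCurves.ZpExtension.IsTopGeneratorPair κ₁ κ₂ γ₁ γ₂)] [NeZero (NumberField.discr K).natAbs] (N : ℕ) [NeZero N] (f : CuspForm (CongruenceSubgroup.Gamma0 N) 2), Literature.NumberTheory.EllipticCurves.ModularForms.IsNewformOf W f → (N : ℤ) = W.conductorNorm ℤ → Literature.NumberTheory.EllipticCurves.IsImaginaryQuadratic K → ((Ideal.span {(p : ℤ)}).primesOver (NumberField.RingOfIntegers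 K)).ncard = 2 → ((p : ℕ) : NumberField.RingOfIntegers K) ∈ v.asIdeal → ((p : ℕ) : NumberField.RingOfIntegers K) ∈ vbar.asIdeal → vbar ≠ v → (∀ (w : NumberField.InfinitePlace K) (k : NumberField.RingOfIntegers K), k ∈ v.asIdeal ↔ ‖ι.symm (w.embedding (k : K))‖ < 1) → IsCoprime (N : ℤ) (NumberField.discr K) → (∀ ℓ : ℕ, ℓ.Prime → ℓ ∣ N → ((Ideal.span {(ℓ : ℤ)}).primesOver (NumberField.RingOfIntegers K)).ncard = 2) → Odd (NumberField.discr K) → NumberField.discr K ≠ -3 → κ₁.IsCyclotomic → κ₂.IsAnticyclotomic → (haveI : Fact (κ₂.IsTopGenerator γ₂) := ⟨Literature.NumberTheory.EllipticCurves.YanZhu2026.isTopGenerator_of_pair (κ₁ := κ₁) (γ₁ := γ₁)⟩; Module.IsTorsion (Literature.NumberTheory.EllipticCurves.IwasawaAlgebra p) (Literature.NumberTheory.EllipticCurves.Castella2018.AcSelmer.XAc (W.baseChange K) p κ₂ vbar ∅ γ₂)) := by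
  intro hIn hmodP W _ _ p _ hp hgood ha0 hs K _ _ ι v vbar κ₁ κ₂ γ₁ γ₂ _ _ N _ f hf hN hK hsplit hv hvbar hvv hι hcop hHeeg hodd hne3 hκ₁ hκ₂
  by_cases hh : p ∣ NumberField.classNumber K
  · exact hA2 hIn hmodP W p hp hgood ha0 hs K ι v vbar κ₁ κ₂ γ₁ γ₂ N f hf hN hK hsplit hv hvbar hvv hι hcop hHeeg hodd hne3 hκ₁ hκ₂ hh
  · exact Summit.BirchSwinnertonDyer.BirchSwinnertonDyer.Theorems.SignedBaseChangeAcDivXAcTorsionOfLongoVigni.xAcTorsionSS_of_longoVigni_castellaWan hLV hCW hIn hmodP W p hp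
      hgood ha0 hs K ι v vbar κ₁ κ₂ γ₁ γ₂ N f hf hN hK hsplit hv hvbar hvv hι hcop hHeeg hodd hne3 hκ₁ hκ₂ hh

/-- **The kernel census of the crux along line `bdpline` v23, refereed form**: `AnticyclotomicEisensteinDivisibility` follows from
{Yan–Zhu 2026 Thms. 4.2 (2), 4.7 (guarded), 3.3 (ordinary slice); Longo–Vigni 2019 Thm. 1.4 and Castella–Wan 2024 Thm. 6.8 (stub (a1),
`p ∤ h_K`); the statement (a2) (`p ∣ h_K`, verbatim the registered stub); Greenberg 2016 Props. 4.1.1/4.2.2 and Greenberg 2006 Props.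
3.2/4.1/4.2/§5 A (finite exponent); BSTW24 Prop. 6.27 (i) (PRE) and BCS25 Prop. 4.2.2 (S3)} and the research statement S1 (`hS1`, verbatim
the registered `stub_bdpLowerHalfRatSS`). CONDITIONAL on every displayed hypothesis; nothing about BSD is proved.
[cite: LongoVigni2019, Thm. 1.4] [cite: CastellaWan2023, Thm. 6.8] [cite: YanZhu2024MainConjNonCM, Thms. 3.3, 4.2 (2), 4.7]
[cite: BurungaleCastellaSkinner2025, Prop. 4.2.2] [claim: BurungaleSkinnerTianWan2024, status: under-review] [cite: Greenberg2016Selmer, Prop. 4.1.1] -/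
theorem anticyclotomicEisensteinDivisibility_of_refereedFacts
    (h42 : Literature.NumberTheory.EllipticCurves.YanZhu2026.thm42_XGr₂_isTorsion_charIdeal_le_greenbergAnyRoot)
    (h47 : Literature.NumberTheory.EllipticCurves.YanZhu2026.thm47_ord_localised_iff_greenbergAnyRoot_localised_guarded)
    (h33 : Literature.NumberTheory.EllipticCurves.YanZhu2026.thm33_exists_isHidaRankinLFunction)
    (hLV : ∀ (W : WeierstrassCurve ℚ) [W.IsGloballyMinimal] (K : Type) [Field K] [NumberField K]
      (p : ℕ) [Fact p.Prime] (κ : ZpExtension K p) (𝔭 𝔭' : IsDedekindDomain.HeightOneSpectrum (NumberField.RingOfIntegers K)),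
      AcSigned.longoVigni2019_thm14_signedSelmerDual_rank_one W K p κ 𝔭 𝔭')
    (hCW : ∀ (N : ℕ) [NeZero N] (W : WeierstrassCurve ℚ) [W.IsGloballyMinimal] (K : Type) [Field K]
      [NumberField K] (p : ℕ) [Fact p.Prime] (κ : ZpExtension K p) (𝔭 𝔭' : IsDedekindDomain.HeightOneSpectrum (NumberField.RingOfIntegers K)),
      AcSigned.castellaWan2024_proofThm68_transferInputs N W K p κ 𝔭 𝔭')
    (hA2 : SignedTwoVariableInputs → Literature.NumberTheory.EllipticCurves.ModularForms.nonempty_modularParametrizationData → ∀ (W : WeierstrassCurve ℚ) [W.IsElliptic] [W.IsGloballyMinimal] (p : ℕ) [Fact p.Prime], 5 ≤ p → W.HasGoodReductionAtPrime p → W.frobeniusTrace p = 0 → Literature.NumberTheory.EllipticCurves.Rank1Residual.Surj W p → ∀ (K : Type) [Field K] [NumberField K] (ι : PadicAlgCl p ≃+* ℂ) (v vbar : IsDedekindDomain.HeightOneSpectrum (NumberField.RingOfIntegers K)) (κ₁ κ₂ : Literature.NumberTheory.EllipticCurves.ZpExtension K p) (γ₁ γ₂ : Field.absoluteGaloisGroup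 K) [Fact (Literature.NumberTheory.EllipticCurves.ZpExtension.IsTopGeneratorPair κ₁ κ₂ γ₁ γ₂)] [NeZero (NumberField.discr K).natAbs] (N : ℕ) [NeZero N] (f : CuspForm (CongruenceSubgroup.Gamma0 N) 2), Literature.NumberTheory.EllipticCurves.ModularForms.IsNewformOf W f → (N : ℤ) = W.conductorNorm ℤ → Literature.NumberTheory.EllipticCurves.IsImaginaryQuadratic K → ((Ideal.span {(p : ℤ)}).primesOver (NumberField.RingOfIntegers K)).ncard = 2 → ((p : ℕ) : NumberField.RingOfIntegers K) ∈ v.asIdeal → ((p : ℕ) : NumberField.RingOfIntegers K) ∈ vbar.asIdeal → vbar ≠ v → (∀ (w : NumberField.InfinitePlace K) (k : NumberField.RingOfIntegers K), k ∈ v.asIdeal ↔ ‖ι.symm (w.embedding (k : K))‖ < 1) → IsCoprime (N : ℤ) (NumberField.discr K) → (∀ ℓ : ℕ, ℓ.Prime → ℓ ∣ N → ((Ideal.span {(ℓ : ℤ)}).primesOver (NumberField.RingOfIntegers K)).ncard = 2) → Odd (NumberField.discr K) → NumberField.discr K ≠ -3 → κ₁.IsCyclotomic → κ₂.IsAnticyclotomic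 → p ∣ NumberField.classNumber K → (haveI : Fact (κ₂.IsTopGenerator γ₂) := ⟨Literature.NumberTheory.EllipticCurves.YanZhu2026.isTopGenerator_of_pair (κ₁ := κ₁) (γ₁ := γ₁)⟩; Module.IsTorsion (Literature.NumberTheory.EllipticCurves.IwasawaAlgebra p) (Literature.NumberTheory.EllipticCurves.Castella2018.AcSelmer.XAc (W.baseChange K) p κ₂ vbar ∅ γ₂)))
    (hGr : Literature.NumberTheory.IwasawaTheory.Greenberg2016.prop411_selmer_isAlmostDivisible ∧ Literature.NumberTheory.IwasawaTheory.Greenberg2016.prop422_localCohomology_isAlmostDivisible ∧ Literature.NumberTheory.IwasawaTheory.Greenberg2006.sec5A_localH2_subsingleton_of_LOC1 ∧ Literature.NumberTheory.IwasawaTheory.Greenberg2006.prop41_globalEulerPoincareCorank ∧ Literature.NumberTheory.IwasawaTheory.Greenberg2006.prop42_localEulerPoincareCorank ∧ Literature.NumberTheory.IwasawaTheory.Greenberg2006.prop32_cohomology_isCofinitelyGenerated)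
    (h627 : Literature.NumberTheory.EllipticCurves.BurungaleSkinnerTianWan2024.prop627_span_minus_eq_span_bdp_supersingular_PRE)
    (h422e : Literature.NumberTheory.EllipticCurves.BurungaleCastellaSkinner2025.prop422_exists_isBDPLFunction_mu_eq_zero)
    (hS1 : SignedTwoVariableInputs → Literature.NumberTheory.EllipticCurves.ModularForms.nonempty_modularParametrizationData → ∀ (W : WeierstrassCurve ℚ) [W.IsElliptic] [W.IsGloballyMinimal] (p : ℕ) [Fact p.Prime], 5 ≤ p → W.HasGoodReductionAtPrime p → W.frobeniusTrace p = 0 → Literature.NumberTheory.EllipticCurves.Rank1Residual.Surj W p → ∀ (K : Type) [Field K] [NumberField K] (ι : PadicAlgCl p ≃+* ℂ) (v vbar : IsDedekindDomain.HeightOneSpectrum (NumberField.RingOfIntegers K)) (κ₁ κ₂ : Literature.NumberTheory.EllipticCurves.ZpExtension K p) (γ₁ γ₂ : Field.absoluteGaloisGroup K) [Fact (Literature.NumberTheory.EllipticCurves.ZpExtension.IsTopGeneratorPair κ₁ κ₂ γ₁ γ₂)] [NeZero (NumberField.discr K).natAbs] (N : ℕ) [NeZero N] (f : CuspForm (CongruenceSubgroup.Gamma0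 N) 2), Literature.NumberTheory.EllipticCurves.ModularForms.IsNewformOf W f → (N : ℤ) = W.conductorNorm ℤ → Literature.NumberTheory.EllipticCurves.IsImaginaryQuadratic K → ((Ideal.span {(p : ℤ)}).primesOver (NumberField.RingOfIntegers K)).ncard = 2 → ((p : ℕ) : NumberField.RingOfIntegers K) ∈ v.asIdeal → ((p : ℕ) : NumberField.RingOfIntegers K) ∈ vbar.asIdeal → vbar ≠ v → (∀ (w : NumberField.InfinitePlace K) (k : NumberField.RingOfIntegers K), k ∈ v.asIdeal ↔ ‖ι.symm (w.embedding (k : K))‖ < 1) → IsCoprime (N : ℤ) (NumberField.discr K) → (∀ ℓ : ℕ, ℓ.Prime → ℓ ∣ N → ((Ideal.span {(ℓ : ℤ)}).primesOver (NumberField.RingOfIntegers K)).ncard = 2) → Odd (NumberField.discr K) → NumberField.discr K ≠ -3 → κ₁.IsCyclotomic → κ₂.IsAnticyclotomic → (haveI : Fact (κ₂.IsTopGenerator γ₂) := ⟨Literature.NumberTheory.EllipticCurves.YanZhu2026.isTopGenerator_of_pair (κ₁ := κ₁) (γ₁ := γ₁)⟩; Module.IsTorsion (Literature.NumberTheory.EllipticCurves.IwasawaAlgebra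 p) (Literature.NumberTheory.EllipticCurves.Castella2018.AcSelmer.XAc (W.baseChange K) p κ₂ vbar ∅ γ₂)) → ∀ (ΩK : ℂ) (Ωp' : (Literature.NumberTheory.EllipticCurves.unrIntegers p)ˣ) (L : Literature.NumberTheory.EllipticCurves.UnrSeries p), ΩK ≠ 0 → Literature.NumberTheory.EllipticCurves.IsBDPLFunction ι v κ₂ γ₂ f ΩK ((Ωp' : Literature.NumberTheory.EllipticCurves.unrIntegers p) : PadicComplex p) L → ∀ J : ℤ_[p] →+* PadicComplexInt p, (∀ x : ℤ_[p], ((J x : PadicComplexInt p) : PadicComplex p) = ((x : ℚ_[p]) : PadicComplex p)) → ∀ (J₀ : Literature.NumberTheory.EllipticCurves.unrIntegers p →+* PadicComplexInt p), (∀ x : Literature.NumberTheory.EllipticCurves.unrIntegers p, ((J₀ x : PadicComplexInt p) : PadicComplex p) = (x : PadicComplex p)) → ∃ k : ℕ, ∀ y ∈ (haveI : Fact (κ₂.IsTopGenerator γ₂) := ⟨Literature.NumberTheory.EllipticCurves.YanZhu2026.isTopGenerator_of_pair (κ₁ := κ₁) (γ₁ := γ₁)⟩; Literature.NumberTheory.EllipticCurves.Castella2018.AcSelmer.XAc.charIdeal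 (W.baseChange K) p κ₂ vbar ∅ γ₂).map (PowerSeries.map J), PowerSeries.C (((p : ℕ) : PadicComplexInt p) ^ k) * y ∈ Ideal.span {PowerSeries.map J₀ L}) :
    Summit.BirchSwinnertonDyer.BirchSwinnertonDyer.Theses.SignedBaseChange.AnticyclotomicEisensteinDivisibility :=
  anticyclotomicEisensteinDivisibility_of_xAcTorsionSS h42 h47 h33 (xAcTorsionSS_of_refereed_of_classDvd hLV hCW hA2) hGr
    h627 h422e hS1

end Summit.BirchSwinnertonDyer.BirchSwinnertonDyer.Theorems.SignedBaseChangeAcDivOfFactsRefereed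

end
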